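import Literature.NumberTheory.NumberFields.ArithmeticEquivalence
import Literature.NumberTheory.LFunctions.IdealNormCount
import Mathlib.NumberTheory.LSeries.Injectivity
import Mathlib.RingTheory.PowerSeries.Basic
import Mathlib.Data.Nat.Factorization.Induction
import Mathlib.Data.Finsupp.Multiset
import HarnessLib

/-!
# Perlis 1977, Theorem 1: proofs — (a) ⇔ (b), equal zeta functions iff arithmetic equivalence

Topic `NumberTheory/NumberFields` (namespace `Literature.NumberTheory.NumberFields`). Everything in
this file is PROVED (theorems only; no new definition of a named fact, no `sorry`).

Source: R. Perlis, *On the equation `ζ_K(s) = ζ_{K'}(s)`*, J. Number Theory **9** (1977) 342–360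
(bib key `Perlis1977`), Theorem 1 (p. 345) and its proof (pp. 346–347), read from the materialised
text. This file proves the FIRST conjunct of the named fact
`Literature.NumberTheory.NumberFields.Perlis1977_thm1` (`ArithmeticEquivalence.lean`):

* `dedekindZeta_eq_iff_arithmeticallyEquivalent` — **(a) ⇔ (b) of Perlis's Theorem 1**: two number
  fields have the same Dedekind zeta function (Mathlib's Dirichlet series
  `NumberField.dedekindZeta`, as functions `ℂ → ℂ`) iff every rational prime has the same
  splitting type in both (`ArithmeticallyEquivalent`);

together with the degree clause of the "furthermore" part in the strong form needed later:

* `finrank_eq_of_eventually_splittingType_eq`, `ArithmeticallyEquivalent.finrank_eq` — condition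
  (c) (equal splitting types at almost all primes), in particular (b), forces `[K:ℚ] = [K':ℚ]`.

## The argument

Perlis (p. 346) proves (a) ⇒ (b) by extracting the Dirichlet coefficients `A(n) = #{I : N(I) = n}`
("letting `s → +∞`", here Mathlib's `LSeries_eq_iff_of_abscissaOfAbsConv_lt_top`) and observing
that the numbers `A(p^k)`, `k ≥ 0`, determine the splitting type of `p`; he obtains (b) ⇒ (a) only
through (d) and the functional equation. Here BOTH directions are done by the direct count, which
is the content of his remark "`B(p^f)` determines the splitting type": writing
`p𝓞_K = P₁^{e₁}⋯P_g^{e_g}`, `fᵢ = f(Pᵢ|p)`, the ideals of norm `p^k` are the `∏ Pᵢ^{cᵢ}` with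
`Σ cᵢ fᵢ = k` (unique factorisation; the `eᵢ` play no role), so

  `Σ_k A(p^k) X^k = ∏ᵢ (1 - X^{fᵢ})⁻¹ =: F_T`,  `T = (f₁,…,f_g)` the splitting type

(`idealNormCount_prime_pow_eq_coeff`, via Mathlib's `PowerSeries.coeff_prod` over
`Finset.finsuppAntidiag` and an explicit bijection `I ↦ (P ↦ f(P|p)·v_P(I))`); and the map
`T ↦ F_T` is injective on multisets of positive integers (`typeSeries_injective`: the least `m > 0`
with a nonzero coefficient is `min T`, that coefficient is the multiplicity of `min T`, and one
factor `(1 - X^m)⁻¹` can be cancelled — induction on `#T`). Since `A` is multiplicative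
(`Literature.NumberTheory.LFunctions.idealNormCount_mul_of_coprime`, tree file
`LFunctions/IdealNormCount.lean`), `A = A'` iff `A(p^k) = A'(p^k)` for all prime powers
(`Nat.recOnPosPrimePosCoprime`), whence (a) ⇔ (b).

For the degree: at a prime `p ∤ D_K` the factorisation of `p` is squarefree
(`nodup_normalizedFactors_of_not_dvd_discr`) and `N(p𝓞_K) = p^{[K:ℚ]} = ∏ p^{fᵢ}`
(`prod_splittingNorms`, `splittingNorms_eq_map_of_nodup`), so `[K:ℚ] = Σ fᵢ` is the sum of the
splitting type; almost every prime is unramified in both fields and there are infinitely many primes.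

## References

* [Perlis1977] R. Perlis, *On the equation `ζ_K(s) = ζ_{K'}(s)`*, J. Number Theory 9 (1977),
  342–360: Theorem 1, (a) ⇔ (b) and "`[K:ℚ] = [K':ℚ]`" (pp. 345–347).
-/

noncomputable section

open Ideal UniqueFactorizationMonoid NumberField Filter PowerSeries Finset
open Literature.NumberTheory.LFunctions

namespace Literature.NumberTheory.NumberFields

/-! ## Generating series of a splitting type -/

/-- The geometric series in `X^f`: `Σ_{j ≥ 0} X^{f j} = (1 - X^f)⁻¹` (for `f > 0`), i.e. the power
series whose `n`-th coefficient is `1` if `f ∣ n` and `0` otherwise. [folklore] -/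
def geomSeries (f : ℕ) : PowerSeries ℤ := PowerSeries.mk fun n => if f ∣ n then 1 else 0

/-- The generating series `F_T = ∏_{f ∈ T} (1 - X^f)⁻¹` of a splitting type `T = (f₁, …, f_g)`;
its `k`-th coefficient counts the solutions of `Σ cᵢ fᵢ = k` in naturals `cᵢ`. [folklore] -/
def typeSeries (T : Multiset ℕ) : PowerSeries ℤ := (T.map geomSeries).prod

/-- Coefficients of the geometric series in `X^f`. [folklore] -/
theorem coeff_geomSeries (f n : ℕ) : coeff n (geomSeries f) = if f ∣ n then 1 else 0 := by
  rw [geomSeries, coeff_mk]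

/-- The constant coefficient of `geomSeries f` is `1`. [folklore] -/
theorem coeff_zero_geomSeries (f : ℕ) : coeff 0 (geomSeries f) = 1 := by
  rw [coeff_geomSeries, if_pos (dvd_zero f)]

/-- `Σ_j X^{fj} = 1 + X^f · Σ_j X^{fj}` for `f > 0`. [folklore] -/
theorem geomSeries_eq (f : ℕ) (hf : 0 < f) : geomSeries f = 1 + X ^ f * geomSeries f := by
  ext n
  rw [map_add, coeff_X_pow_mul', coeff_one, coeff_geomSeries]
  rcases Nat.eq_zero_or_pos n with rfl | hn
  · rw [if_pos (dvd_zero f), if_pos rfl, if_neg (not_le.mpr hf), add_zero]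
  · rw [if_neg hn.ne', zero_add]
    by_cases hfn : f ≤ n
    · rw [if_pos hfn, coeff_geomSeries]
      have key : f ∣ n ↔ f ∣ n - f := by
        constructor
        · intro h
          exact Nat.dvd_sub h dvd_rfl
        · intro h
          have : n = n - f + f := (Nat.sub_add_cancel hfn).symm
          rw [this]
          exact dvd_add h dvd_rfl
      by_cases hd : f ∣ n
      · rw [if_pos hd, if_pos (key.mp hd)]
      · rw [if_neg hd, if_neg (fun h => hd (key.mpr h))]
    · rw [if_neg hfn, if_neg]
      exact fun h => hfn (Nat.le_of_dvd hn h)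

/-- `(1 - X^f) · Σ_j X^{fj} = 1` for `f > 0`. [folklore] -/
theorem one_sub_X_pow_mul_geomSeries (f : ℕ) (hf : 0 < f) : (1 - X ^ f) * geomSeries f = 1 := by
  have h := geomSeries_eq f hf
  linear_combination h

/-- Cancellation of a geometric-series factor. [folklore] -/
theorem geomSeries_mul_cancel {f : ℕ} (hf : 0 < f) {G G' : PowerSeries ℤ}
    (h : geomSeries f * G = geomSeries f * G') : G = G' := by
  have key : ∀ H : PowerSeries ℤ, (1 - X ^ f) * (geomSeries f * H) = H := fun H => by
    rw [← mul_assoc, one_sub_X_pow_mul_geomSeries f hf, one_mul]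
  rw [← key G, h, key]

/-- `F_∅ = 1`. [folklore] -/
@[simp] theorem typeSeries_zero : typeSeries 0 = 1 := by
  simp [typeSeries]

/-- `F_{f ∷ T} = (1 - X^f)⁻¹ · F_T`. [folklore] -/
@[simp] theorem typeSeries_cons (f : ℕ) (T : Multiset ℕ) :
    typeSeries (f ::ₘ T) = geomSeries f * typeSeries T := by
  simp [typeSeries]

/-- The constant coefficient of `F_T` is `1`. [folklore] -/
theorem coeff_zero_typeSeries (T : Multiset ℕ) : coeff 0 (typeSeries T) = 1 := by
  induction T using Multiset.induction_on with
  | empty => rw [typeSeries_zero, coeff_one, if_pos rfl]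
  | cons f T ih =>
    rw [typeSeries_cons, coeff_zero_eq_constantCoeff_apply, map_mul,
      ← coeff_zero_eq_constantCoeff_apply, ← coeff_zero_eq_constantCoeff_apply,
      coeff_zero_geomSeries, ih, one_mul]

/-- **Low coefficients of `F_T`.** If every entry of `T` is `≥ m > 0` then the coefficients of
`F_T` in degrees `0 < j < m` vanish and the coefficient in degree `m` is the multiplicity of `m` in
`T`. [folklore] -/
theorem coeff_typeSeries_of_forall_le {m : ℕ} (hm : 0 < m) (T : Multiset ℕ)
    (hT : ∀ f ∈ T, m ≤ f) :
    (∀ j, 0 < j → j < m → coeff j (typeSeries T) = 0) ∧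
      coeff m (typeSeries T) = (T.count m : ℤ) := by
  induction T using Multiset.induction_on with
  | empty =>
    refine ⟨fun j hj _ => ?_, ?_⟩
    · rw [typeSeries_zero, coeff_one, if_neg hj.ne']
    · rw [typeSeries_zero, coeff_one, if_neg hm.ne', Multiset.count_zero, Nat.cast_zero]
  | cons f T ih =>
    have hfm : m ≤ f := hT f (Multiset.mem_cons_self f T)
    have hf : 0 < f := hm.trans_le hfm
    obtain ⟨ih1, ih2⟩ := ih fun g hg => hT g (Multiset.mem_cons_of_mem hg)
    have expand : typeSeries (f ::ₘ T) =
        typeSeries T + X ^ f * (geomSeries f * typeSeries T) := by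
      rw [typeSeries_cons]
      conv_lhs => rw [geomSeries_eq f hf]
      ring
    refine ⟨fun j hj hjm => ?_, ?_⟩
    · rw [expand, map_add, coeff_X_pow_mul', if_neg (by omega), add_zero]
      exact ih1 j hj hjm
    · rw [expand, map_add, coeff_X_pow_mul', ih2]
      by_cases hfm' : f = m
      · subst hfm'
        rw [if_pos le_rfl, Nat.sub_self, coeff_zero_eq_constantCoeff_apply, map_mul,
          ← coeff_zero_eq_constantCoeff_apply, ← coeff_zero_eq_constantCoeff_apply,
          coeff_zero_geomSeries, one_mul, Multiset.count_cons_self, Nat.cast_add, Nat.cast_one,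
          coeff_zero_typeSeries]
      · rw [if_neg (fun h => hfm' (le_antisymm h hfm)), add_zero,
          Multiset.count_cons_of_ne (Ne.symm hfm')]

/-- **`T ↦ F_T` is injective on multisets of positive integers** (Perlis, proof of Theorem 1,
"`B(p^f)` determines the splitting type"): the numbers of solutions of `Σ cᵢ fᵢ = k`, `k ≥ 0`,
determine the multiset `(fᵢ)`. [cite: Perlis1977, proof of Thm. 1, (a) ⇒ (b) (p. 346)] -/
theorem typeSeries_injective :
    ∀ (n : ℕ) (T T' : Multiset ℕ), Multiset.card T = n → (∀ f ∈ T, 0 < f) → (∀ f ∈ T', 0 < f) →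
      typeSeries T = typeSeries T' → T = T' := by
  intro n
  induction n using Nat.strong_induction_on with
  | _ n ih =>
  intro T T' hcard hT hT' heq
  by_cases hTT : T + T' = 0
  · have h1 : T = 0 := Multiset.le_zero.mp (hTT ▸ Multiset.le_add_right T T')
    have h2 : T' = 0 := Multiset.le_zero.mp (hTT ▸ Multiset.le_add_left T' T)
    rw [h1, h2]
  · obtain ⟨m, hmem, hmin⟩ := (T + T').toFinset.exists_min_image id
      (Multiset.toFinset_nonempty.mpr hTT)
    simp only [Multiset.mem_toFinset, id] at hmem hmin
    have hm : 0 < m := by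
      rcases Multiset.mem_add.mp hmem with h | h
      · exact hT m h
      · exact hT' m h
    have hcT := (coeff_typeSeries_of_forall_le hm T
      fun f hf => hmin f (Multiset.mem_add.mpr (Or.inl hf))).2
    have hcT' := (coeff_typeSeries_of_forall_le hm T'
      fun f hf => hmin f (Multiset.mem_add.mpr (Or.inr hf))).2
    have hcount : T.count m = T'.count m := by
      have := hcT.symm.trans (heq ▸ hcT')
      exact_mod_cast this
    have hmT : m ∈ T := by
      rw [← Multiset.count_pos]
      have h := Multiset.count_pos.mpr hmem
      rw [Multiset.count_add] at h
      omega
    have hmT' : m ∈ T' := by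
      rw [← Multiset.count_pos, ← hcount, Multiset.count_pos]
      exact hmT
    rw [← Multiset.cons_erase hmT, ← Multiset.cons_erase hmT'] at heq ⊢
    rw [typeSeries_cons, typeSeries_cons] at heq
    have heq' := geomSeries_mul_cancel hm heq
    have hlt : Multiset.card (T.erase m) < n := by
      rw [Multiset.card_erase_of_mem hmT, ← hcard]
      exact Nat.pred_lt (Multiset.card_pos_iff_exists_mem.mpr ⟨m, hmT⟩).ne'
    rw [ih _ hlt (T.erase m) (T'.erase m) rfl (fun f hf => hT f (Multiset.mem_of_mem_erase hf))
      (fun f hf => hT' f (Multiset.mem_of_mem_erase hf)) heq']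

/-- The `k`-th coefficient of `∏_{i ∈ S} (1 - X^{fᵢ})⁻¹` is the number of `l : S → ℕ` with
`Σ lᵢ = k` and `fᵢ ∣ lᵢ` (i.e. of solutions of `Σ cᵢ fᵢ = k`). [folklore] -/
theorem coeff_prod_geomSeries {ι : Type*} [DecidableEq ι] (S : Finset ι) (f : ι → ℕ) (k : ℕ) :
    coeff k (∏ i ∈ S, geomSeries (f i)) =
      (((S.finsuppAntidiag k).filter (fun l => ∀ i ∈ S, f i ∣ l i)).card : ℤ) := by
  rw [coeff_prod]
  simp_rw [coeff_geomSeries]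
  rw [← Finset.sum_boole]
  refine Finset.sum_congr rfl fun l _ => ?_
  exact Finset.prod_boole

/-! ## Ideals of prime-power norm and the splitting type -/

section NumberField

variable {K : Type*} [Field K] [NumberField K]

/-- `F_T` for the splitting type `T` of `p` is the product over the distinct primes `P ∣ p` of the
geometric series in `X^{f(P|p)}`. [folklore] -/
theorem typeSeries_splittingType (p : ℕ) :
    typeSeries (splittingType K p) =
      ∏ P ∈ (normalizedFactors (span {(p : 𝓞 K)})).toFinset, geomSeries (P.inertiaDeg ℤ) := by
  rw [splittingType, typeSeries, Finset.prod_eq_multiset_prod, Multiset.toFinset_val,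
    Multiset.map_map]
  rfl

/-- Entries of a splitting type are positive (`f(P|p) ≥ 1`). [folklore] -/
theorem pos_of_mem_splittingType {p : ℕ} (hp : p.Prime) {f : ℕ} (hf : f ∈ splittingType K p) :
    0 < f := by
  rw [splittingType, Multiset.mem_map] at hf
  obtain ⟨P, hP, rfl⟩ := hf
  rw [Multiset.mem_dedup] at hP
  obtain ⟨hPp, -⟩ := (mem_normalizedFactors_span_iff hp).1 hP
  exact Ideal.inertiaDeg_pos (R := ℤ) (q := P)

/-- A prime factor of an ideal of norm `p^k` is a prime factor of `p𝓞 K`. [folklore] -/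
theorem mem_normalizedFactors_span_of_absNorm_eq {p : ℕ} (hp : p.Prime) {k : ℕ}
    {I : Ideal (𝓞 K)} (hI : absNorm I = p ^ k) {P : Ideal (𝓞 K)}
    (hP : P ∈ normalizedFactors I) : P ∈ normalizedFactors (span {(p : 𝓞 K)}) := by
  have h := IdealNormCount.mem_primesOver_of_mem_normalizedFactors hp hI hP
  exact (mem_normalizedFactors_span_iff hp).2 ⟨h.1, h.2⟩

/-- An ideal of norm `p^k` is the product of the distinct primes above `p` raised to their
multiplicities in it. [folklore] -/
theorem eq_prod_pow_count_of_absNorm_eq {p : ℕ} (hp : p.Prime)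
    {k : ℕ} {I : Ideal (𝓞 K)} (hI : absNorm I = p ^ k) :
    I = ∏ P ∈ (normalizedFactors (span {(p : 𝓞 K)})).toFinset,
      P ^ (normalizedFactors I).count P := by
  have hI0 : I ≠ ⊥ := by
    intro h
    rw [h, absNorm_bot] at hI
    exact pow_ne_zero k hp.ne_zero hI.symm
  conv_lhs => rw [← associated_iff_eq.mp (prod_normalizedFactors hI0)]
  refine Finset.prod_multiset_count_of_subset _ _ fun P hP => ?_
  rw [Multiset.mem_toFinset] at hP ⊢
  exact mem_normalizedFactors_span_of_absNorm_eq hp hI hP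

/-- The norm of `∏_{P ∣ p} P^{c_P}` is `p^{Σ f(P|p) c_P}`. [folklore] -/
theorem absNorm_prod_pow_eq {p : ℕ} (hp : p.Prime)
    (c : Ideal (𝓞 K) → ℕ) :
    absNorm (∏ P ∈ (normalizedFactors (span {(p : 𝓞 K)})).toFinset, P ^ c P) =
      p ^ ∑ P ∈ (normalizedFactors (span {(p : 𝓞 K)})).toFinset, P.inertiaDeg ℤ * c P := by
  rw [map_prod, ← Finset.prod_pow_eq_pow_sum]
  refine Finset.prod_congr rfl fun P hP => ?_
  rw [Multiset.mem_toFinset] at hP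
  obtain ⟨hPp, hPl⟩ := (mem_normalizedFactors_span_iff hp).1 hP
  rw [map_pow, pow_mul, Ideal.pow_inertiaDeg p P]

/-- The multiplicity of a prime `P ∣ p` in `∏_{Q ∣ p} Q^{c_Q}` is `c_P`. [folklore] -/
theorem count_normalizedFactors_prod_pow {p : ℕ}
    (c : Ideal (𝓞 K) →₀ ℕ) (hc : c.support ⊆ (normalizedFactors (span {(p : 𝓞 K)})).toFinset)
    (P : Ideal (𝓞 K)) :
    (normalizedFactors (∏ Q ∈ (normalizedFactors (span {(p : 𝓞 K)})).toFinset, Q ^ c Q)).count P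
      = c P := by
  have hprod : ∏ Q ∈ (normalizedFactors (span {(p : 𝓞 K)})).toFinset, Q ^ c Q =
      (Finsupp.toMultiset c).prod := by
    rw [Finsupp.prod_toMultiset, Finsupp.prod_of_support_subset c hc _ fun Q _ => pow_zero Q]
  rw [hprod, normalizedFactors_prod_eq, Multiset.map_congr rfl fun x _ => normalize_eq x,
    Multiset.map_id', Finsupp.count_toMultiset]
  intro Q hQ
  rw [Finsupp.mem_toMultiset] at hQ
  have hQ' := hc hQ
  rw [Multiset.mem_toFinset] at hQ'
  exact (prime_of_normalized_factor Q hQ').irreducible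

/-- **Ideals of norm `p^k` ↔ solutions of `Σ c_P f(P|p) = k`.** The number `A(p^k)` of integral
ideals of norm `p^k` is the number of `l : {P ∣ p} → ℕ` with `Σ l_P = k` and `f(P|p) ∣ l_P`
(bijection `I ↦ (P ↦ f(P|p)·v_P(I))`, inverse `l ↦ ∏ P^{l_P / f(P|p)}`).
[cite: Perlis1977, proof of Thm. 1 (p. 346, "`B(p^f)`")] -/
theorem idealNormCount_prime_pow_eq_card {p : ℕ} (hp : p.Prime)
    (k : ℕ) :
    idealNormCount K (p ^ k) =
      ((((normalizedFactors (span {(p : 𝓞 K)})).toFinset).finsuppAntidiag k).filter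
        (fun l => ∀ P ∈ (normalizedFactors (span {(p : 𝓞 K)})).toFinset,
          P.inertiaDeg ℤ ∣ l P)).card := by
  set S := (normalizedFactors (span {(p : 𝓞 K)})).toFinset with hS
  set A := (Ideal.finite_setOf_absNorm_eq (S := 𝓞 K) (p ^ k)).toFinset with hA
  have hcardA : idealNormCount K (p ^ k) = A.card := by
    rw [idealNormCount, hA,
      ← Set.ncard_eq_toFinset_card _ (Ideal.finite_setOf_absNorm_eq (S := 𝓞 K) (p ^ k)),
      ← Nat.card_coe_set_eq]
    rfl
  rw [hcardA]
  -- positivity of the inertia degrees of the primes above `p`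
  have hfpos : ∀ P ∈ S, 0 < P.inertiaDeg ℤ := fun P hP => by
    rw [hS, Multiset.mem_toFinset] at hP
    obtain ⟨hPp, -⟩ := (mem_normalizedFactors_span_iff hp).1 hP
    exact Ideal.inertiaDeg_pos (R := ℤ) (q := P)
  -- the two maps
  let i : Ideal (𝓞 K) → (Ideal (𝓞 K) →₀ ℕ) := fun I =>
    Finsupp.onFinset S (fun P => if P ∈ S then P.inertiaDeg ℤ * (normalizedFactors I).count P
      else 0) (fun P h => by
        by_contra hP
        exact h (if_neg hP))
  let j : (Ideal (𝓞 K) →₀ ℕ) → Ideal (𝓞 K) := fun l => ∏ P ∈ S, P ^ (l P / P.inertiaDeg ℤ)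
  have hi_apply : ∀ I P, i I P = if P ∈ S then P.inertiaDeg ℤ * (normalizedFactors I).count P
      else 0 := fun I P => Finsupp.onFinset_apply
  refine Finset.card_nbij' i j ?_ ?_ ?_ ?_
  · -- `i` maps ideals of norm `p^k` to admissible exponent vectors
    intro I hI
    rw [Finset.mem_coe, hA, Set.Finite.mem_toFinset, Set.mem_setOf_eq] at hI
    rw [Finset.mem_coe, Finset.mem_filter, Finset.mem_finsuppAntidiag]
    refine ⟨⟨?_, Finsupp.support_onFinset_subset⟩, fun P hP => ?_⟩
    · have h1 : ∑ P ∈ S, i I P = ∑ P ∈ S, P.inertiaDeg ℤ * (normalizedFactors I).count P :=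
        Finset.sum_congr rfl fun P hP => by rw [hi_apply, if_pos hP]
      rw [h1]
      apply Nat.pow_right_injective hp.two_le
      simp only
      rw [← absNorm_prod_pow_eq hp, ← eq_prod_pow_count_of_absNorm_eq hp hI, hI]
    · rw [hi_apply, if_pos hP]
      exact Dvd.intro _ rfl
  · -- `j` maps admissible exponent vectors to ideals of norm `p^k`
    intro l hl
    rw [Finset.mem_coe, Finset.mem_filter, Finset.mem_finsuppAntidiag] at hl
    obtain ⟨⟨hsum, hsupp⟩, hdvd⟩ := hl
    rw [Finset.mem_coe, hA, Set.Finite.mem_toFinset, Set.mem_setOf_eq]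
    show absNorm (∏ P ∈ S, P ^ (l P / P.inertiaDeg ℤ)) = p ^ k
    rw [absNorm_prod_pow_eq hp, ← hsum]
    congr 1
    exact Finset.sum_congr rfl fun P hP => Nat.mul_div_cancel' (hdvd P hP)
  · -- `j ∘ i = id` on ideals of norm `p^k`
    intro I hI
    rw [Finset.mem_coe, hA, Set.Finite.mem_toFinset, Set.mem_setOf_eq] at hI
    show ∏ P ∈ S, P ^ (i I P / P.inertiaDeg ℤ) = I
    conv_rhs => rw [eq_prod_pow_count_of_absNorm_eq hp hI]
    refine Finset.prod_congr rfl fun P hP => ?_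
    rw [hi_apply, if_pos hP, Nat.mul_div_cancel_left _ (hfpos P hP)]
  · -- `i ∘ j = id` on admissible exponent vectors
    intro l hl
    rw [Finset.mem_coe, Finset.mem_filter, Finset.mem_finsuppAntidiag] at hl
    obtain ⟨⟨-, hsupp⟩, hdvd⟩ := hl
    -- the exponent vector `c_P = l_P / f(P|p)` as a finitely supported function
    let c : Ideal (𝓞 K) →₀ ℕ := Finsupp.onFinset S (fun P => l P / P.inertiaDeg ℤ)
      (fun P h => by
        by_contra hP
        have : l P = 0 := by
          by_contra hlP
          exact hP (hsupp (Finsupp.mem_support_iff.mpr hlP))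
        rw [this, Nat.zero_div] at h
        exact h rfl)
    have hc : c.support ⊆ S := Finsupp.support_onFinset_subset
    have hj : j l = ∏ Q ∈ S, Q ^ c Q :=
      Finset.prod_congr rfl fun Q _ => by rw [Finsupp.onFinset_apply]
    ext P
    show i (j l) P = l P
    rw [hi_apply, hj]
    by_cases hP : P ∈ S
    · rw [if_pos hP, count_normalizedFactors_prod_pow c hc P, Finsupp.onFinset_apply,
        Nat.mul_div_cancel' (hdvd P hP)]
    · rw [if_neg hP]
      by_contra hlP
      exact hP (hsupp (Finsupp.mem_support_iff.mpr (Ne.symm hlP)))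

/-- **`Σ_k A(p^k) X^k = F_T`**: the number of integral ideals of norm `p^k` is the `k`-th
coefficient of the generating series of the splitting type of `p`; in particular it depends only on
the splitting type. [cite: Perlis1977, proof of Thm. 1 (p. 346)] -/
theorem idealNormCount_prime_pow_eq_coeff {p : ℕ} (hp : p.Prime) (k : ℕ) :
    (idealNormCount K (p ^ k) : ℤ) = coeff k (typeSeries (splittingType K p)) := by
  rw [typeSeries_splittingType, coeff_prod_geomSeries, idealNormCount_prime_pow_eq_card hp k]

/-- Fields in which `p` has the same splitting type have the same number of ideals of norm `p^k`.
[cite: Perlis1977, proof of Thm. 1 (p. 346)] -/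
theorem idealNormCount_prime_pow_eq_of_splittingType_eq {K' : Type*} [Field K'] [NumberField K']
    {p : ℕ} (hp : p.Prime) (h : splittingType K p = splittingType K' p) (k : ℕ) :
    idealNormCount K (p ^ k) = idealNormCount K' (p ^ k) := by
  have := idealNormCount_prime_pow_eq_coeff (K := K) hp k
  rw [h, ← idealNormCount_prime_pow_eq_coeff (K := K') hp k] at this
  exact_mod_cast this

/-- **"`B(p^f)` determines the splitting type"**: if `K` and `K'` have the same number of ideals
of norm `p^k` for every `k`, then `p` has the same splitting type in `K` and in `K'`.
[cite: Perlis1977, proof of Thm. 1, (a) ⇒ (b) (p. 346)] -/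
theorem splittingType_eq_of_idealNormCount_prime_pow_eq {K' : Type*} [Field K'] [NumberField K']
    {p : ℕ} (hp : p.Prime) (h : ∀ k, idealNormCount K (p ^ k) = idealNormCount K' (p ^ k)) :
    splittingType K p = splittingType K' p := by
  refine typeSeries_injective _ _ _ rfl (fun f hf => pos_of_mem_splittingType hp hf)
    (fun f hf => pos_of_mem_splittingType hp hf) ?_
  ext k
  rw [← idealNormCount_prime_pow_eq_coeff hp, ← idealNormCount_prime_pow_eq_coeff hp, h k]

/-- By multiplicativity, the ideal counts agree everywhere as soon as they agree at prime powers.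
[folklore] -/
theorem idealNormCount_eq_of_prime_pow {K' : Type*} [Field K'] [NumberField K']
    (h : ∀ p : ℕ, p.Prime → ∀ k, idealNormCount K (p ^ k) = idealNormCount K' (p ^ k)) (n : ℕ) :
    idealNormCount K n = idealNormCount K' n := by
  induction n using Nat.recOnPosPrimePosCoprime with
  | prime_pow p k hp _ => exact h p hp k
  | zero => rw [idealNormCount_zero, idealNormCount_zero]
  | one => rw [idealNormCount_one, idealNormCount_one]
  | coprime a b _ _ hab iha ihb =>
    rw [idealNormCount_mul_of_coprime K hab, idealNormCount_mul_of_coprime K' hab, iha, ihb]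

/-- The abscissa of absolute convergence of `ζ_K` is finite (`≤ 2`; in fact `= 1`). [folklore] -/
theorem abscissaOfAbsConv_idealNormCount_lt_top :
    LSeries.abscissaOfAbsConv (fun n ↦ (idealNormCount K n : ℂ)) < ⊤ := by
  have h2 : (1 : ℝ) < (2 : ℂ).re := by norm_num
  have := (LSeriesSummable_dedekindZeta (K := K) h2).abscissaOfAbsConv_le
  exact lt_of_le_of_lt this (EReal.coe_lt_top _)

/-- **Equal zeta functions ⇔ equal ideal counts** ("letting `s → +∞`", i.e. a Dirichlet series
converging somewhere determines its coefficients). [cite: Perlis1977, proof of Thm. 1, (a) ⇒ (b) (p. 346)] -/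
theorem dedekindZeta_eq_iff_idealNormCount_eq {K' : Type*} [Field K'] [NumberField K'] :
    dedekindZeta K = dedekindZeta K' ↔ ∀ n, idealNormCount K n = idealNormCount K' n := by
  constructor
  · intro h n
    rcases eq_or_ne n 0 with rfl | hn
    · rw [idealNormCount_zero, idealNormCount_zero]
    have h' : LSeries (fun n ↦ (idealNormCount K n : ℂ)) =
        LSeries (fun n ↦ (idealNormCount K' n : ℂ)) := by
      funext s
      exact congr_fun h s
    have := (LSeries_eq_iff_of_abscissaOfAbsConv_lt_top abscissaOfAbsConv_idealNormCount_lt_top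
      abscissaOfAbsConv_idealNormCount_lt_top).mp h' n hn
    exact_mod_cast this
  · intro h
    funext s
    rw [dedekindZeta_eq_LSeries, dedekindZeta_eq_LSeries]
    congr 1
    funext n
    rw [h n]

/-- **Perlis 1977, Theorem 1, (a) ⇔ (b).** Two number fields have identical Dedekind zeta
functions iff they are arithmetically equivalent (every rational prime has the same splitting type
in both). This is the first conjunct of the named fact `Perlis1977_thm1`.
[cite: Perlis1977, Thm. 1 ((a) ⇔ (b), pp. 345–346)] -/
theorem dedekindZeta_eq_iff_arithmeticallyEquivalent {K K' : Type*} [Field K] [NumberField K]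
    [Field K'] [NumberField K'] :
    dedekindZeta K = dedekindZeta K' ↔ ArithmeticallyEquivalent K K' := by
  rw [dedekindZeta_eq_iff_idealNormCount_eq]
  constructor
  · intro h p hp
    exact splittingType_eq_of_idealNormCount_prime_pow_eq hp fun k => h (p ^ k)
  · intro h
    exact idealNormCount_eq_of_prime_pow fun p hp k =>
      idealNormCount_prime_pow_eq_of_splittingType_eq hp (h p hp) k

/-- Symmetric form: arithmetically equivalent fields have the same zeta function.
[cite: Perlis1977, Thm. 1 ((b) ⇒ (a))] -/
theorem ArithmeticallyEquivalent.dedekindZeta_eq {K K' : Type*} [Field K] [NumberField K]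
    [Field K'] [NumberField K'] (h : ArithmeticallyEquivalent K K') :
    dedekindZeta K = dedekindZeta K' :=
  dedekindZeta_eq_iff_arithmeticallyEquivalent.mpr h

/-! ## The degree is determined by the splitting types at almost all primes -/

/-- `∏_{f ∈ T} p^f = p^{Σ T}`. [folklore] -/
theorem prod_map_pow_eq_pow_sum (p : ℕ) (T : Multiset ℕ) :
    (T.map (p ^ ·)).prod = p ^ T.sum := by
  induction T using Multiset.induction_on with
  | empty => simp
  | cons f T ih => rw [Multiset.map_cons, Multiset.prod_cons, Multiset.sum_cons, pow_add, ih]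

/-- **At an unramified prime the splitting type sums to the degree**: if `p ∤ D_K` then
`Σᵢ fᵢ = [K:ℚ]` (all `eᵢ = 1` and `Σ eᵢ fᵢ = [K:ℚ]`). [folklore] -/
theorem sum_splittingType_eq_finrank {p : ℕ} (hp : p.Prime) (hd : ¬ (p : ℤ) ∣ NumberField.discr K) :
    (splittingType K p).sum = Module.finrank ℚ K := by
  have h1 := prod_splittingNorms (K := K) p hp.ne_zero
  rw [splittingNorms_eq_map_of_nodup hp (nodup_normalizedFactors_of_not_dvd_discr hp hd),
    prod_map_pow_eq_pow_sum] at h1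
  exact Nat.pow_right_injective hp.two_le h1

/-- **Condition (c) forces equal degrees**: if almost every prime has the same splitting type in
`K` and `K'` then `[K:ℚ] = [K':ℚ]` (take a prime unramified in both, of which there are infinitely
many). [cite: Perlis1977, Thm. 1 ("`[K:ℚ] = [K':ℚ]`", p. 347)] -/
theorem finrank_eq_of_eventually_splittingType_eq {K K' : Type*} [Field K] [NumberField K]
    [Field K'] [NumberField K']
    (h : ∀ᶠ p : ℕ in cofinite, p.Prime → splittingType K p = splittingType K' p) :
    Module.finrank ℚ K = Module.finrank ℚ K' := by
  have hev := (h.and (eventually_not_dvd_discr K)).and (eventually_not_dvd_discr K')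
  have hfr : ∃ᶠ p : ℕ in cofinite, p.Prime :=
    Filter.frequently_cofinite_iff_infinite.mpr Nat.infinite_setOf_prime
  obtain ⟨p, ⟨⟨hpq, hd⟩, hd'⟩, hp⟩ := (hev.and_frequently hfr).exists
  rw [← sum_splittingType_eq_finrank hp hd, ← sum_splittingType_eq_finrank hp hd', hpq hp]

/-- **Arithmetically equivalent fields have the same degree.**
[cite: Perlis1977, Thm. 1 ("`[K:ℚ] = [K':ℚ]`", p. 347)] -/
theorem ArithmeticallyEquivalent.finrank_eq {K K' : Type*} [Field K] [NumberField K]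
    [Field K'] [NumberField K'] (h : ArithmeticallyEquivalent K K') :
    Module.finrank ℚ K = Module.finrank ℚ K' :=
  finrank_eq_of_eventually_splittingType_eq (Eventually.of_forall h)

end NumberField

end Literature.NumberTheory.NumberFields
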